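import Literature.AlgebraicGeometry.Motives.WeilJacobianUniversal
import Literature.AlgebraicGeometry.Motives.JacobianAbelTheoremOfWeilModel
import Literature.AlgebraicGeometry.Motives.AbelianVarietyDimZeroProofs
import Literature.AlgebraicGeometry.Motives.VarietiesProperProofs
import Literature.AlgebraicGeometry.Motives.GeometricallyIntegralAlgClosed
import Literature.AlgebraicGeometry.HodgeTheory.CurveHodgeGenusBound
import HarnessLib

/-!
# Abel's theorem for every Jacobian of a smooth projective complex curve (the (W)-road adapter)

Layer `Literature/AlgebraicGeometry/Motives`, namespace `Literature.AlgebraicGeometry.Motives.Jacobian`.  THEOREMS ONLY; no definition,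
no named fact, no instance.  Cell `hodgecm-mathlib` (D-0151), road G4, pen ruling #10 («THE (W)-FORK OPENS NOW»): this file discharges the
binder `hAbel` of ★ `galoisCover_pullback_isWeilPairingAdjoint_norm_of_three_leaves` (`Motives/JacobianGaloisCoverNormAdjointOfThreeLeaves`)
through WEIL'S MODEL:

* ★ `WeilJacobian.exists_hom_fJ_comp_eq_abelJacobi` (`Motives/WeilJacobianUniversal`, the letter (W1)): for a smooth projective curve `C`
  of genus `g ≥ 1` over `K = K̄`, `char K = 0`, Weil's Jacobian `(Jac, f)` maps to every Jacobian `𝒥` of `C`, `f ≫ v = α_{R₀(j₀)}`;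
* ★ `Jacobian.ajSum_congr_linEquiv_of_weilModel` (`Motives/JacobianAbelTheoremOfWeilModel`, letters (g4-1d)/(g4-1e) modulo `v`): given
  such a `v`, the Abel–Jacobi sum `aj_c` of `𝒥` is constant on linear equivalence classes (Abel's theorem on Weil's model, transported);
* genus `0`: `dim 𝒥 ≤ g(C) = 0` (★ `HodgeTheory.Jacobian.dim_le_curveGenus`), and an abelian variety of dimension `0` has exactly one rational point
  (★ `AbelianVariety.isIso_hom_of_dim_eq_zero`), so the statement is trivial.

Main statement (`ajSum_congr_linEquiv_of_isSmoothProjective`, the `hAbel` binder of GLUE III token for token): for a smooth projective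
complex curve `C`, `𝒥 : Jacobian C`, `c ∈ C(ℂ)` and Cartier divisors `E ∼ F` on `C`, **`aj_c(E) = aj_c(F)`**.

## References
* [Milne1986JacobianVarieties] J. S. Milne, *Jacobian Varieties*, in Cornell–Silverman (eds.), *Arithmetic Geometry* (1986), Thm. 1.1,
  §6 Prop. 6.1 and §7 Thm. 7.1.
* [Lange2023AbelianVarietiesComplex] H. Lange, *Abelian Varieties over the Complex Numbers*, Springer (2023), §4.1.3 (pp. 205–207, the
  Abel–Jacobi map, Thm. 4.1.4 p. 206).
-/

set_option autoImplicit false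

noncomputable section

universe u

open CategoryTheory CategoryTheory.Limits AlgebraicGeometry MonoidalCategory CartesianMonoidalCategory MonObj
open Literature.NumberTheory.DiophantineGeometry
open Literature.NumberTheory.DiophantineGeometry.AlgFunctionField
open Literature.AlgebraicGeometry.RelativeSpec

namespace Literature.AlgebraicGeometry.Motives

open RatFn FieldPoint CartierDivisor CurvePlaces WeilJacobian

/-! ## §1 An abelian variety of dimension `0` has a single rational point -/

namespace AbelianVariety

/-- **`A(K)` is a singleton when `dim A = 0`**: the structure morphism `A → Spec K` is an isomorphism (★ `isIso_hom_of_dim_eq_zero`), so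
any two sections of it coincide. [folklore] -/
private theorem subsingleton_points_of_dim_eq_zero {K : Type u} [Field K] (A : AbelianVariety K) (h : A.dim = 0) :
    Subsingleton (A.Points K) := by
  haveI := A.isIso_hom_of_dim_eq_zero h
  refine ⟨fun a b => Over.OverMorphism.ext ?_⟩
  rw [← cancel_mono A.X.hom, Over.w a, Over.w b]

end AbelianVariety

/-! ## §2 Abel's theorem for every Jacobian of a smooth projective complex curve -/

namespace Jacobian

/-- **ABEL'S THEOREM for every Jacobian `𝒥` of a smooth projective complex curve** (the `hAbel` binder of ★
`galoisCover_pullback_isWeilPairingAdjoint_norm_of_three_leaves`): `E ∼ F ⟹ aj_c(E) = aj_c(F)`.  Genus `≥ 1`: Weil's model maps to `𝒥`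
compatibly with the Abel–Jacobi maps (★ `WeilJacobian.exists_hom_fJ_comp_eq_abelJacobi`, with the hypotheses of Weil's construction
discharged exactly as in ★ `curveGenus_le_jacobian_dim`), and Abel's theorem on Weil's model transports (★ `ajSum_congr_linEquiv_of_weilModel`);
genus `0`: `dim 𝒥 = 0` (★ `HodgeTheory.Jacobian.dim_le_curveGenus`) and `𝒥(ℂ)` is a single point.
[cite: Milne1986JacobianVarieties, Thm. 1.1, §6 Prop. 6.1 and §7 Thm. 7.1] [cite: Lange2023AbelianVarietiesComplex, §4.1.3 Thm. 4.1.4 (p. 206)] -/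
theorem ajSum_congr_linEquiv_of_isSmoothProjective {C : SchemeOver ℂ} [IsIntegral C.left] [IsLocallyNoetherian C.left]
    (𝒥 : Jacobian C) (hC : IsSmoothProjective 1 C) (c : AlgPoints C ℂ) {E F : CartierDivisor C.left} (h : E.LinEquiv F) :
    𝒥.ajSum c E = 𝒥.ajSum c F := by
  haveI := hC.smoothOfRelativeDimension
  haveI : IsProper C.hom := IsSmoothProjective.isProper_holds hC
  rcases Nat.eq_zero_or_pos (curveGenus C) with hzero | hpos
  · -- genus `0`: `dim 𝒥 = 0`, one rational point
    have hd : 𝒥.J.dim = 0 := Nat.le_zero.mp (hzero ▸ HodgeTheory.Jacobian.dim_le_curveGenus C hC 𝒥)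
    haveI := AbelianVariety.subsingleton_points_of_dim_eq_zero 𝒥.J hd
    exact Subsingleton.elim _ _
  · -- genus `≥ 1`: Weil's model
    haveI : GeometricallyIntegral C.hom := geometricallyIntegral_of_isAlgClosed C.hom
    have hX : CechPseudoCoherentAt C := cechPseudoCoherentAt_of_general cechComplex_pseudoCoherent_general_holds C
    have hg : (genus ℂ (curveBC C (strPt (K := ℂ) ℂ)).left.functionField : ℤ) ≤ curveGenus C := by
      exact_mod_cast (curveGenus_curveBC C (strPt (K := ℂ) ℂ)).le
    haveI := infinite_algPoints C
    let a := Infinite.natEmbedding (AlgPoints C ℂ)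
    let s : Fin (2 * curveGenus C) → (𝟙_ (SchemeOver ℂ) ⟶ C) := fun j ↦ unitToSpecOver ℂ ≫ a j
    have hs : Function.Injective s := fun j₁ j₂ h ↦ by
      have h' := congrArg (toUnit (specOver ℂ ℂ) ≫ ·) h
      simp only [s] at h'
      rw [← Category.assoc, toUnit_unitToSpecOver, Category.id_comp, ← Category.assoc, toUnit_unitToSpecOver,
        Category.id_comp] at h'
      exact Fin.val_injective (a.injective h')
    have hW : (chartW C (curveGenus C) hC.isProjectiveOver).Nonempty :=
      chartW_nonempty C (curveGenus C) hC.isProjectiveOver (nonempty_generalLocus_of_sections C s hs (by omega))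
    obtain ⟨v, hv⟩ := WeilJacobian.exists_hom_fJ_comp_eq_abelJacobi C hC.isProjectiveOver hX (curveGenus C) hg hW ⟨0, hpos⟩ 𝒥
    exact ajSum_congr_linEquiv_of_weilModel hC.isProjectiveOver hX (curveGenus C) hg hW ⟨0, hpos⟩ 𝒥 v hv c h

end Jacobian

end Literature.AlgebraicGeometry.Motives

end
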